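import Summits.BirchSwinnertonDyer.BirchSwinnertonDyer.Theorems.PrintX10bStubAExactAtPOfClauses
import Summits.BirchSwinnertonDyer.BirchSwinnertonDyer.Theorems.PrintX10bStubAExactAtPAnnSat
import HarnessLib

/-!
# STUB A of the shared μ-item — D1's letter `Stmt.annSatAtP` holds (by name)

Helper toward the registered stub `stub_h4AtS` of the shared deciding μ-item (`MuInequalityCoherentPairOfPrintCG`,
stmt-BirchSwinnertonDyer-23428).  The D1 letter `HeegnerMuPartH4AtS.Stmt.annSatAtP` (LEAD `bsd-line-x10b-p1` g9,
`Theorems/PrintX10bStubAExactAtPOfClauses`: the (ANN-SAT) half of the (Exact) clauses `Stmt.exactAtP` at the places `v ∣ p`)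
is CLOSED BY NAME by x9-p1-w4 g8's frame theorem `HeegnerMuPartH4AtSAnnSat.annSatAtP` (`Theorems/PrintX10bStubAExactAtPAnnSat`),
whose statement is the letter's body verbatim.  With `HeegnerMuPartH4AtS.h4AtS_of_exactRep_of_annSat` this reduces `Stmt.h4AtS`
to the representability letter `Stmt.exactRepAtP` (x9-p1-w2 g8).  Bookkeeping toward one stub of one crux; no summit statement
is proved here; BSD is not proved by any of this.
-/

set_option linter.dupNamespace false
set_option autoImplicit false

namespace Summit.BirchSwinnertonDyer.BirchSwinnertonDyer.Theorems.HeegnerMuPartH4AtS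

/-- **`Stmt.annSatAtP` holds**: the (ANN-SAT) half of (Exact) at `v ∣ p` on every Thm 4.1.3 frame of the μ-letter
(`HeegnerMuPartH4AtSAnnSat.annSatAtP`, by name). [cite: Howard2004HeegnerKolyvagin, §1.3 H.4, Lemma 3.1.1 and Def. 3.2.6 (arXiv p. 7 L78–82, p. 15–16)]
[cite: MilneADT2006, Ch. I Cor. 2.3] -/
theorem annSatAtP_holds : Stmt.annSatAtP :=
  HeegnerMuPartH4AtSAnnSat.annSatAtP

/-- **`Stmt.h4AtS` from the representability letter alone**: H.4 at every place of `S` follows from `Stmt.exactRepAtP`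
(x9-p1-w2 g8's (EXACT-REP) half), the (ANN-SAT) half being `annSatAtP_holds`.
[cite: Howard2004HeegnerKolyvagin, §1.3 H.4 and Def. 3.2.6 (arXiv p. 7 L78–82, p. 16)] -/
theorem h4AtS_of_exactRep (HR : Stmt.exactRepAtP) : Stmt.h4AtS :=
  h4AtS_of_exactRep_of_annSat HR annSatAtP_holds

end Summit.BirchSwinnertonDyer.BirchSwinnertonDyer.Theorems.HeegnerMuPartH4AtS
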